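import Summits.CriticalPhenomena.SAWScalingLimit.Theorems.SAWRenewalTightnessSubseqIdentificationBoundaryAreaLawReduction
import Summits.CriticalPhenomena.SAWScalingLimit.Theorems.SAWRenewalTightnessSubseqIdentificationSleHalfPlaneAreaLaw
import Summits.CriticalPhenomena.SAWScalingLimit.Theorems.SAWRenewalTightnessSubseqIdentificationSleAreaLawGlue
import Summits.CriticalPhenomena.SAWScalingLimit.Theorems.SAWRenewalTightnessSubseqIdentificationLatticeAreaLawOfLimitLaw
import Summits.CriticalPhenomena.SAWScalingLimit.Theorems.SAWRenewalTightnessSubseqIdentificationLatticeAreaLawNecessityGlue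
import Summits.CriticalPhenomena.SAWScalingLimit.Theorems.SAWRenewalTightnessSubseqIdentificationDockOfCrux
import Summits.CriticalPhenomena.SAWScalingLimit.Theorems.EventualTight.Negative.TightnessNecessary

/-!
# Line `boundary-area-law` for crux `SubseqIdentification` (stmt-CriticalPhenomena-0783): ONE WINDOW SUFFICES
# — the crux from the dock and the lattice data of a single witnessed flat window (no global tightness)

The landed reduction `SubseqIdentification_of_dock_of_latticeAreaLaw` (p99729) takes the dock S1, the lattice
area law S4 IN EVERY Dobrushin domain with a flat window, and `EventualTight` (tightness in EVERY domain). Its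
proof, however, consumes the lattice inputs in ONE reference domain only (the square of `stub_referenceWindow`).
This file records the sharper, domain-local form of the line's sufficiency statement and its converse:

* `subseqLimitsExist_of_isTightAlongMesh` — Prokhorov along the mesh in ONE domain: tightness along `𝓝[>] 0`
  of the pushed SAW laws of `(D; a, b)` gives, along every mesh sequence, a subsequence converging weakly to a
  probability measure (the proof of `subseqLimitsExist_of_eventualTight`, started one step later).
* `SubseqIdentification_of_dock_of_window` — **S1 ∧ W → crux**, where the WINDOW PACKAGE `W` says: there is
  SOME Dobrushin domain `D₀` with an endpoint approximation, a flat window at some `x₀ ∉ {a₀, b₀}`, tightness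
  along the mesh of its pushed SAW laws, and the lattice area law at `x₀`. No hypothesis on any other domain:
  the crux follows from the conformal dock plus lattice facts about ONE square.
* `window_of_sawScalingLimit` — **`SAW.SAWScalingLimit → W`** (the reference square of `stub_referenceWindow`;
  tightness along the mesh is necessary for convergence in law,
  `EventualTight.Negative.exists_isTightMeasureSet_image_of_convergesInLawToSLE`; the area law by
  `latticeAreaLaw_of_sawScalingLimit`). So `W`, like S1, is implied by the conjecture as typed.
* `sawScalingLimit_iff_eventualTight_and_dock_and_window` — `SAWScalingLimit ↔ EventualTight ∧ S1 ∧ W`.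

For the planners: the lattice content this line needs beyond tightness is the two-sided area law in ONE
concrete square (an item may be filed in that form); the all-domains stub S4 remains registered and is also
necessary (`latticeAreaLaw_of_sawScalingLimit`). No named fact is used; axioms `propext`, `Classical.choice`,
`Quot.sound`.
-/

open MeasureTheory Filter Topology Set
open scoped NNReal ENNReal BoundedContinuousFunction

namespace Summit.CriticalPhenomena.SAWScalingLimit.Theorems.SubseqIdentification.BoundaryAreaLaw

open Literature.Probability.RandomPlanarGeometry Literature.Probability.LatticeModels
open Summit.CriticalPhenomena.SAWScalingLimit.Theses.SAWParafermion (SubseqIdentification)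
open Summit.CriticalPhenomena.SAWScalingLimit.Theses.SAWRenewalTightness (EventualTight closes)

/-- **Prokhorov along the mesh in one domain.** If the pushed critical SAW laws of `(D; a, b)` (endpoint
approximation `(a_δ, b_δ)`) are tight along `𝓝[>] 0`, then along every mesh sequence `s → 0⁺` some
subsequence converges weakly to a probability measure on `CurveClass ℂ`: the laws are probability measures
past the junk meshes (`Negative.eventually_isProbabilityMeasure_law`), the image laws along the sequence form a
tight set (`isTightMeasureSet_range_of_eventually`), and Prokhorov on the Polish `CurveClass ℂ`
(`isCompact_closure_of_isTightMeasureSet`) extracts the subsequence. [folklore] -/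
theorem subseqLimitsExist_of_isTightAlongMesh {D : DobrushinDomain} {a b : ℝ → Site 2}
    (hab : SAW.IsEndpointApprox D a b)
    (hT' : IsTightAlongMesh (fun δ (γ : SAW.DomainSAW D.carrier δ (a δ) (b δ)) => γ.curve)
      (fun δ => SAW.law D.carrier δ (a δ) (b δ))) :
    ∀ (s : ℕ → ℝ), Tendsto s atTop (𝓝[>] (0 : ℝ)) →
      ∃ φ : ℕ → ℕ, StrictMono φ ∧ ∃ μ : Measure (CurveClass ℂ), IsProbabilityMeasure μ ∧
        ∀ f : CurveClass ℂ →ᵇ ℝ,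
          Tendsto (fun n => ∫ γ, f γ.curve
              ∂(SAW.law D.carrier (s (φ n)) (a (s (φ n))) (b (s (φ n)))))
            atTop (𝓝 (∫ x, f x ∂μ)) := by
  -- adapted from `subseqLimitsExist_of_eventualTight` (BoundaryAreaLawReduction.lean), one step later
  intro s hs
  obtain ⟨N, hN⟩ := eventually_atTop.1 (hs.eventually
    (Summit.CriticalPhenomena.SAWScalingLimit.Theorems.SubseqIdentification.Negative.eventually_isProbabilityMeasure_law
      hab))
  have hN' : ∀ n, IsProbabilityMeasure (SAW.law D.carrier (s (n + N)) (a (s (n + N))) (b (s (n + N)))) :=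
    fun n => hN _ (N.le_add_left n)
  let ν : ℕ → ProbabilityMeasure (CurveClass ℂ) := fun n =>
    ⟨(SAW.law D.carrier (s (n + N)) (a (s (n + N))) (b (s (n + N)))).map (fun γ => γ.curve),
      Measure.isProbabilityMeasure_map (SAW.DomainSAW.measurable_of_top _).aemeasurable⟩
  have hνapply : ∀ n (K : Set (CurveClass ℂ)), IsClosed K → (ν n : Measure (CurveClass ℂ)) Kᶜ =
      SAW.law D.carrier (s (n + N)) (a (s (n + N))) (b (s (n + N))) ((fun γ => γ.curve) ⁻¹' Kᶜ) :=
    fun n K hK => Measure.map_apply (SAW.DomainSAW.measurable_of_top _) hK.isOpen_compl.measurableSet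
  have htight : IsTightMeasureSet
      {((μ : ProbabilityMeasure (CurveClass ℂ)) : Measure (CurveClass ℂ)) | μ ∈ Set.range ν} := by
    have hrange : {((μ : ProbabilityMeasure (CurveClass ℂ)) : Measure (CurveClass ℂ)) | μ ∈ Set.range ν}
        = Set.range (fun n => (ν n : Measure (CurveClass ℂ))) := by
      ext x
      simp only [Set.mem_range, Set.mem_setOf_eq]
      constructor
      · rintro ⟨μ, ⟨n, rfl⟩, rfl⟩
        exact ⟨n, rfl⟩
      · rintro ⟨n, rfl⟩
        exact ⟨ν n, ⟨n, rfl⟩, rfl⟩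
    rw [hrange]
    haveI : ∀ n, IsFiniteMeasure ((fun n => (ν n : Measure (CurveClass ℂ))) n) := fun n => by
      change IsFiniteMeasure (ν n : Measure (CurveClass ℂ))
      infer_instance
    refine isTightMeasureSet_range_of_eventually fun ε hε => ?_
    obtain ⟨K, hK, hev⟩ := hT' ε hε
    refine ⟨K, hK, ?_⟩
    have hs' : Tendsto (fun n => s (n + N)) atTop (𝓝[>] (0 : ℝ)) := hs.comp (tendsto_add_atTop_nat N)
    filter_upwards [hs'.eventually hev] with n hn
    rwa [hνapply n K hK.isClosed]
  have hcomp := isCompact_closure_of_isTightMeasureSet htight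
  obtain ⟨μ, -, φ, hφ, hlim⟩ := hcomp.isSeqCompact fun n => subset_closure (Set.mem_range_self n)
  refine ⟨fun n => φ n + N, fun m n hmn => Nat.add_lt_add_right (hφ hmn) N, μ, inferInstance,
    fun f => ?_⟩
  have := (ProbabilityMeasure.tendsto_iff_forall_integral_tendsto.1 hlim) f
  refine this.congr fun n => ?_
  change ∫ x, f x ∂((SAW.law D.carrier (s (φ n + N)) (a (s (φ n + N))) (b (s (φ n + N)))).map
    (fun γ => γ.curve)) = _
  exact integral_map (SAW.DomainSAW.measurable_of_top _).aemeasurable f.continuous.aestronglyMeasurable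

/-- **ONE WINDOW SUFFICES: `S1 ∧ W → SubseqIdentification`.** The crux follows from the dock S1
(identification up to κ, one κ per mesh sequence) and the WINDOW PACKAGE `W`: SOME Dobrushin domain `D₀` with
an endpoint approximation `(a₀, b₀)`, a flat window `D₀ ∩ B(x₀, ρ₀) = {Im z > Im x₀} ∩ B(x₀, ρ₀)` at
`x₀ ∉ {a₀, b₀}`, tightness along the mesh of its pushed critical SAW laws, and the lattice two-sided area law at
`x₀`. Proof = the line's composition run in `D₀` only: a subsequential limit `μ₀` in `D₀` along `s ∘ φ`
(`subseqLimitsExist_of_isTightAlongMesh`), one `κ` for `μ` and `μ₀` (S1 along `s ∘ φ`), the limit area law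
(`stub_areaLawOfLimit`, non-degeneracy from the pin) and the κ-pin
(`stub_kappaPinGlue stub_kappaPinHalfPlane stub_windowTransport`). [folklore] -/
theorem SubseqIdentification_of_dock_of_window :
    (∀ (s : ℕ → ℝ), Tendsto s atTop (𝓝[>] (0 : ℝ)) →
        ∃ κ : ℝ≥0, 0 < κ ∧
          ∀ (D : DobrushinDomain) (a b : ℝ → Site 2), SAW.IsEndpointApprox D a b →
            ∀ (μ : Measure (CurveClass ℂ)), IsProbabilityMeasure μ →
              (∀ f : CurveClass ℂ →ᵇ ℝ,
                Tendsto (fun n => ∫ γ, f γ.curve ∂(SAW.law D.carrier (s n) (a (s n)) (b (s n))))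
                  atTop (𝓝 (∫ x, f x ∂μ))) →
              IsSLELaw κ D μ) →
    (∃ (D₀ : DobrushinDomain) (a₀ b₀ : ℝ → Site 2) (x₀ : ℂ) (ρ₀ : ℝ),
        SAW.IsEndpointApprox D₀ a₀ b₀ ∧ 0 < ρ₀ ∧ x₀ ≠ D₀.pt 0 ∧ x₀ ≠ D₀.pt 1 ∧
          D₀.carrier ∩ Metric.ball x₀ ρ₀ = {z : ℂ | x₀.im < z.im} ∩ Metric.ball x₀ ρ₀ ∧
          IsTightAlongMesh (fun δ (γ : SAW.DomainSAW D₀.carrier δ (a₀ δ) (b₀ δ)) => γ.curve)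
            (fun δ => SAW.law D₀.carrier δ (a₀ δ) (b₀ δ)) ∧
          ∃ C ε₀ : ℝ, 0 < C ∧ 0 < ε₀ ∧ ∀ r : ℝ, 0 < r → r ≤ ε₀ →
            ∀ᶠ δ in 𝓝[>] (0 : ℝ),
              SAW.law D₀.carrier δ (a₀ δ) (b₀ δ) {γ | Metric.infDist x₀ γ.curve.range ≤ r} *
                  ENNReal.ofReal (ε₀ ^ 2) ≤
                ENNReal.ofReal C *
                  SAW.law D₀.carrier δ (a₀ δ) (b₀ δ) {γ | Metric.infDist x₀ γ.curve.range ≤ ε₀} *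
                    ENNReal.ofReal (r ^ 2) ∧
              SAW.law D₀.carrier δ (a₀ δ) (b₀ δ) {γ | Metric.infDist x₀ γ.curve.range ≤ ε₀} *
                  ENNReal.ofReal (r ^ 2) ≤
                ENNReal.ofReal C *
                  SAW.law D₀.carrier δ (a₀ δ) (b₀ δ) {γ | Metric.infDist x₀ γ.curve.range ≤ r} *
                    ENNReal.ofReal (ε₀ ^ 2)) →
    SubseqIdentification := by
  intro h₁ hW D a b hab s μ hs hμ hlim
  obtain ⟨D₀, a₀, b₀, x₀, ρ₀, hab₀, hρ₀, hx0, hx1, hwin, hT₀, C, ε₀, hC, hε₀, hlaw⟩ := hW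
  -- a subsequential limit in the window domain along `s ∘ φ`
  obtain ⟨φ, hφ, μ₀, hμ₀, hlim₀⟩ := subseqLimitsExist_of_isTightAlongMesh hab₀ hT₀ s hs
  have hs' : Tendsto (s ∘ φ) atTop (𝓝[>] (0 : ℝ)) := hs.comp hφ.tendsto_atTop
  -- S1: one `κ` along `s ∘ φ` for both `D` and `D₀`
  obtain ⟨κ, hκ, hdock⟩ := h₁ (s ∘ φ) hs'
  have hD : IsSLELaw κ D μ :=
    hdock D a b hab μ hμ fun f => (hlim f).comp hφ.tendsto_atTop
  have hD₀ : IsSLELaw κ D₀ μ₀ := hdock D₀ a₀ b₀ hab₀ μ₀ hμ₀ hlim₀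
  -- S6: non-degeneracy and the pin for `μ₀ = SLE_κ(D₀)`
  obtain ⟨hnd, hpin⟩ :=
    stub_kappaPinGlue stub_kappaPinHalfPlane stub_windowTransport κ D₀ μ₀ x₀ ρ₀ hκ hD₀ hρ₀ hwin hx0 hx1
  -- S5: the continuum two-sided `r²` law for `μ₀`
  have htwo := stub_areaLawOfLimit D₀ a₀ b₀ (s ∘ φ) μ₀ x₀ hs' hμ₀ hlim₀
    ⟨C, ε₀, hC, hε₀, fun r hr hrε => hs'.eventually (hlaw r hr hrε)⟩ hnd
  have hk : κ = 8 / 3 := hpin htwo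
  rw [hk] at hD
  exact hD

/-- **The window package is necessary: `SAW.SAWScalingLimit → W`.** Witness: the reference square of
`stub_referenceWindow`; tightness along the mesh there is necessary for convergence in law
(`EventualTight.Negative.exists_isTightMeasureSet_image_of_convergesInLawToSLE` +
`isTightAlongMesh_of_isTightMeasureSet_image`), and the lattice area law there is
`latticeAreaLaw_of_sawScalingLimit` (= `stub_latticeAreaLawNecessityGlue` over the landed N1/N2). [folklore] -/
theorem window_of_sawScalingLimit :
    SAW.SAWScalingLimit →
      ∃ (D₀ : DobrushinDomain) (a₀ b₀ : ℝ → Site 2) (x₀ : ℂ) (ρ₀ : ℝ),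
        SAW.IsEndpointApprox D₀ a₀ b₀ ∧ 0 < ρ₀ ∧ x₀ ≠ D₀.pt 0 ∧ x₀ ≠ D₀.pt 1 ∧
          D₀.carrier ∩ Metric.ball x₀ ρ₀ = {z : ℂ | x₀.im < z.im} ∩ Metric.ball x₀ ρ₀ ∧
          IsTightAlongMesh (fun δ (γ : SAW.DomainSAW D₀.carrier δ (a₀ δ) (b₀ δ)) => γ.curve)
            (fun δ => SAW.law D₀.carrier δ (a₀ δ) (b₀ δ)) ∧
          ∃ C ε₀ : ℝ, 0 < C ∧ 0 < ε₀ ∧ ∀ r : ℝ, 0 < r → r ≤ ε₀ →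
            ∀ᶠ δ in 𝓝[>] (0 : ℝ),
              SAW.law D₀.carrier δ (a₀ δ) (b₀ δ) {γ | Metric.infDist x₀ γ.curve.range ≤ r} *
                  ENNReal.ofReal (ε₀ ^ 2) ≤
                ENNReal.ofReal C *
                  SAW.law D₀.carrier δ (a₀ δ) (b₀ δ) {γ | Metric.infDist x₀ γ.curve.range ≤ ε₀} *
                    ENNReal.ofReal (r ^ 2) ∧
              SAW.law D₀.carrier δ (a₀ δ) (b₀ δ) {γ | Metric.infDist x₀ γ.curve.range ≤ ε₀} *
                  ENNReal.ofReal (r ^ 2) ≤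
                ENNReal.ofReal C *
                  SAW.law D₀.carrier δ (a₀ δ) (b₀ δ) {γ | Metric.infDist x₀ γ.curve.range ≤ r} *
                    ENNReal.ofReal (ε₀ ^ 2) := by
  intro h
  obtain ⟨D₀, a₀, b₀, x₀, ρ₀, hab₀, hρ₀, hx0, hx1, hwin⟩ := stub_referenceWindow
  obtain ⟨δ₀, hδ₀, htight⟩ :=
    Summit.CriticalPhenomena.SAWScalingLimit.Theorems.EventualTight.Negative.exists_isTightMeasureSet_image_of_convergesInLawToSLE
      hab₀ (h D₀ a₀ b₀ hab₀)
  refine ⟨D₀, a₀, b₀, x₀, ρ₀, hab₀, hρ₀, hx0, hx1, hwin, ?_,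
    stub_latticeAreaLawNecessityGlue (stub_sleAreaLawGlue stub_sleHalfPlaneAreaLaw stub_windowTransport)
      stub_latticeAreaLawOfLimitLaw h D₀ a₀ b₀ hab₀ x₀ ρ₀ hρ₀ hwin hx0 hx1⟩
  exact isTightAlongMesh_of_isTightMeasureSet_image
    (Eventually.of_forall fun δ => (SAW.DomainSAW.measurable_of_top _).aemeasurable) hδ₀ htight

/-- **`SAWScalingLimit ↔ EventualTight ∧ S1 ∧ W`**: the summit conjunct is tightness of the critical SAW laws
in every domain ∧ identification of subsequential limits up to κ ∧ the window package of ONE square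
(⇐ through `SubseqIdentification_of_dock_of_window` and the route's `closes`). [folklore] -/
theorem sawScalingLimit_iff_eventualTight_and_dock_and_window :
    SAW.SAWScalingLimit ↔
      (EventualTight ∧
        (∀ (s : ℕ → ℝ), Tendsto s atTop (𝓝[>] (0 : ℝ)) →
            ∃ κ : ℝ≥0, 0 < κ ∧
              ∀ (D : DobrushinDomain) (a b : ℝ → Site 2), SAW.IsEndpointApprox D a b →
                ∀ (μ : Measure (CurveClass ℂ)), IsProbabilityMeasure μ →
                  (∀ f : CurveClass ℂ →ᵇ ℝ,
                    Tendsto (fun n => ∫ γ, f γ.curve ∂(SAW.law D.carrier (s n) (a (s n)) (b (s n))))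
                      atTop (𝓝 (∫ x, f x ∂μ))) →
                  IsSLELaw κ D μ) ∧
        ∃ (D₀ : DobrushinDomain) (a₀ b₀ : ℝ → Site 2) (x₀ : ℂ) (ρ₀ : ℝ),
          SAW.IsEndpointApprox D₀ a₀ b₀ ∧ 0 < ρ₀ ∧ x₀ ≠ D₀.pt 0 ∧ x₀ ≠ D₀.pt 1 ∧
            D₀.carrier ∩ Metric.ball x₀ ρ₀ = {z : ℂ | x₀.im < z.im} ∩ Metric.ball x₀ ρ₀ ∧
            IsTightAlongMesh (fun δ (γ : SAW.DomainSAW D₀.carrier δ (a₀ δ) (b₀ δ)) => γ.curve)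
              (fun δ => SAW.law D₀.carrier δ (a₀ δ) (b₀ δ)) ∧
            ∃ C ε₀ : ℝ, 0 < C ∧ 0 < ε₀ ∧ ∀ r : ℝ, 0 < r → r ≤ ε₀ →
              ∀ᶠ δ in 𝓝[>] (0 : ℝ),
                SAW.law D₀.carrier δ (a₀ δ) (b₀ δ) {γ | Metric.infDist x₀ γ.curve.range ≤ r} *
                    ENNReal.ofReal (ε₀ ^ 2) ≤
                  ENNReal.ofReal C *
                    SAW.law D₀.carrier δ (a₀ δ) (b₀ δ) {γ | Metric.infDist x₀ γ.curve.range ≤ ε₀} *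
                      ENNReal.ofReal (r ^ 2) ∧
                SAW.law D₀.carrier δ (a₀ δ) (b₀ δ) {γ | Metric.infDist x₀ γ.curve.range ≤ ε₀} *
                    ENNReal.ofReal (r ^ 2) ≤
                  ENNReal.ofReal C *
                    SAW.law D₀.carrier δ (a₀ δ) (b₀ δ) {γ | Metric.infDist x₀ γ.curve.range ≤ r} *
                      ENNReal.ofReal (ε₀ ^ 2)) :=
  ⟨fun h =>
    ⟨fun D a b hab =>
        Summit.CriticalPhenomena.SAWScalingLimit.Theorems.EventualTight.Negative.exists_isTightMeasureSet_image_of_convergesInLawToSLE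
          hab (h D a b hab),
      stub_dockOfCrux
        (Summit.CriticalPhenomena.SAWScalingLimit.Theorems.SubseqIdentification.Negative.subseqIdentification_of_sawScalingLimit
          h),
      window_of_sawScalingLimit h⟩,
    fun h => closes h.1 (SubseqIdentification_of_dock_of_window h.2.1 h.2.2)⟩

end Summit.CriticalPhenomena.SAWScalingLimit.Theorems.SubseqIdentification.BoundaryAreaLaw
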